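import Mathlib
import HarnessLib
import Summits.NavierStokesRegularity.NavierStokesRegularity.Theorems.PoloidalWindowDoorPoloidalWindowRigidityK2OfLrcSlope

/-!
# Item `LrcModEntire` (stmt-NavierStokesRegularity-20428), registry twist_split v7 — A `C³` SLOPE FUNCTION NEAR A NON-FLAT THREAD PLANE from the GLOBAL bilinear (TH) identity
# (the hypothesis `hμ`/`hslope` of `…TwistingTHPlaneOscillation.weightSource_eq_of_height_eq` and of the ridge law `…TwistingTHRidgeLaw`, produced from the cells' binders)

LEAD of item 20428 ns-poloidal-K2-p3 g14 (`--supports stmt-NavierStokesRegularity-20428 --as helper`).  The (TH) cells (`stub_T2b`, the column's roads) carry the GLOBAL bilinear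
identity `∂₂v_b(t,x)·∂_c v₂(t,x′) = ∂₂v_c(t,x′)·∂_b v₂(t,x)` (`x₂ = x′₂`, `b,c ≠ 2`, `t < 0`; `…TwistingTHRidgeVorticity.thBilinear_of_window`), while the (OSC)/source machinery
(`…TwistingTHPlaneOscillation`, `…TimeHeightShearPressure`) wants a slope FUNCTION `μ(s, y₂)` with `uncurry μ ∈ C³` and the identity `∂₂v_b = μ(s,y₂)∂_b v₂` in a space–time
neighbourhood of every point of the plane.  This file bridges the two near a NON-FLAT plane:

* `exists_slopeFunction_near_plane` — class profile (rate, continuity, Oseen-mild ⇒ jointly analytic Jacobian entries, `…K2OfLrcSlope.analyticOnNhd_uncurry_fderiv_entry`) + the global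
  bilinear identity + ONE point `y₁` of the plane `{y₂ = 0}` of the slice `−1` with `∂_{c₁}v₂(−1,y₁) ≠ 0` ⇒ there is `μ : ℝ → ℝ → ℝ` with `uncurry μ ∈ C³`, the (TH) identity with
  slope `μ(s, y₂)` EVENTUALLY near `(−1, y)` for EVERY `y` of the plane (uniform box `|s+1|, |y₂| < ρ`), and `μ(−1,0) = ∂₂v_{c₁}(−1,y₁)/∂_{c₁}v₂(−1,y₁)`.
  Construction: the ratio of the two entries along the analytic family of points `y₁ + z e₂`, analytic on a box where the denominator stays non-zero, times a product of two
  `ContDiffBump`s (equal to `1` on the half box, supported in the box).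

WHAT THIS IS NOT: not a claim about Navier–Stokes regularity — plumbing for the (TH) column (bears_on LADDER-NS N0, item 20428 / crux 19708; both OPEN, ⟨27893⟩ OPEN).
-/

noncomputable section

-- the summit and its single sub-problem share the name (CONVENTIONS §1), as in every Theorems file
set_option linter.dupNamespace false

namespace Summit.NavierStokesRegularity.NavierStokesRegularity.Theorems.PoloidalWindowDoorLrcModEntireTwistingTHSlopeFunction

open Set Function Filter Topology Metric
open scoped ContDiff
open Literature.Analysis Literature.Analysis.FluidPDE
open Summit.NavierStokesRegularity.NavierStokesRegularity.Theorems.PoloidalWindowDoorPoloidalWindowRigidityK2OfLrcSlope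

variable {C : ℝ} {v : ℝ → EuclideanSpace ℝ (Fin 3) → EuclideanSpace ℝ (Fin 3)}

/-- A Jacobian entry read along the vertical family of points `y₁ + z e₂`: `(s,z) ↦ D(v s)(y₁ + z e₂)[e_j]_i` is analytic at every `(s,z)` with `s < 0`. -/
theorem analyticAt_entry_family (hrate : HasTypeITimeDecay C v) (hcont : ContinuousOn (uncurry v) (Iio (0 : ℝ) ×ˢ univ))
    (hmild : ∀ s t : ℝ, s < t → t < 0 → ∀ x, v t x = UnboundedOperators.heatExtension (v s) (t - s) x - oseenDuhamel 1 s v v t x)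
    (y₁ : EuclideanSpace ℝ (Fin 3)) (j i : Fin 3) {p : ℝ × ℝ} (hp : p.1 < 0) :
    AnalyticAt ℝ (fun q : ℝ × ℝ => fderiv ℝ (v q.1) (y₁ + q.2 • EuclideanSpace.single 2 (1 : ℝ)) (EuclideanSpace.single j 1) i) p := by
  set ι : ℝ × ℝ → ℝ × EuclideanSpace ℝ (Fin 3) := fun q => (q.1, y₁ + q.2 • EuclideanSpace.single 2 (1 : ℝ)) with hι
  have hιa : AnalyticAt ℝ ι p := analyticAt_fst.prod (analyticAt_const.add (analyticAt_snd.smul analyticAt_const))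
  have hmem : ι p ∈ Iio (0 : ℝ) ×ˢ (univ : Set (EuclideanSpace ℝ (Fin 3))) := ⟨hp, mem_univ _⟩
  have hF := analyticOnNhd_uncurry_fderiv_entry hrate hcont hmild j i (ι p) hmem
  exact hF.comp hιa

/-- **A `C³` SLOPE FUNCTION NEAR A NON-FLAT THREAD PLANE.**  See the module docstring. -/
theorem exists_slopeFunction_near_plane (hrate : HasTypeITimeDecay C v) (hcont : ContinuousOn (uncurry v) (Iio (0 : ℝ) ×ˢ univ))
    (hmild : ∀ s t : ℝ, s < t → t < 0 → ∀ x, v t x = UnboundedOperators.heatExtension (v s) (t - s) x - oseenDuhamel 1 s v v t x)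
    (hTH : ∀ t < 0, ∀ x x' : EuclideanSpace ℝ (Fin 3), x 2 = x' 2 → ∀ b c : Fin 3, b ≠ 2 → c ≠ 2 →
      fderiv ℝ (v t) x (EuclideanSpace.single 2 1) b * fderiv ℝ (v t) x' (EuclideanSpace.single c 1) 2 =
        fderiv ℝ (v t) x' (EuclideanSpace.single 2 1) c * fderiv ℝ (v t) x (EuclideanSpace.single b 1) 2)
    {y₁ : EuclideanSpace ℝ (Fin 3)} (hy₁ : y₁ 2 = 0) {c₁ : Fin 3} (hc₁ : c₁ ≠ 2)
    (hne : fderiv ℝ (v (-1)) y₁ (EuclideanSpace.single c₁ 1) 2 ≠ 0) :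
    ∃ μ : ℝ → ℝ → ℝ, ContDiff ℝ 3 (uncurry μ) ∧
      (∀ y : EuclideanSpace ℝ (Fin 3), y 2 = 0 →
        ∀ᶠ z in 𝓝 (((-1 : ℝ), y) : ℝ × EuclideanSpace ℝ (Fin 3)), ∀ b : Fin 3, b ≠ 2 →
          fderiv ℝ (v z.1) z.2 (EuclideanSpace.single 2 1) b = μ z.1 (z.2 2) * fderiv ℝ (v z.1) z.2 (EuclideanSpace.single b 1) 2) ∧
      μ (-1) 0 = fderiv ℝ (v (-1)) y₁ (EuclideanSpace.single 2 1) c₁ / fderiv ℝ (v (-1)) y₁ (EuclideanSpace.single c₁ 1) 2 := by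
  set e₂ : EuclideanSpace ℝ (Fin 3) := EuclideanSpace.single 2 (1 : ℝ) with he₂
  -- numerator and denominator along the family `y₁ + z e₂`
  set D : ℝ × ℝ → ℝ := fun q => fderiv ℝ (v q.1) (y₁ + q.2 • e₂) (EuclideanSpace.single c₁ 1) 2 with hD
  set Nn : ℝ × ℝ → ℝ := fun q => fderiv ℝ (v q.1) (y₁ + q.2 • e₂) (EuclideanSpace.single 2 1) c₁ with hNn
  have hDa : ∀ q : ℝ × ℝ, q.1 < 0 → AnalyticAt ℝ D q := fun q hq => analyticAt_entry_family hrate hcont hmild y₁ c₁ 2 hq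
  have hNa : ∀ q : ℝ × ℝ, q.1 < 0 → AnalyticAt ℝ Nn q := fun q hq => analyticAt_entry_family hrate hcont hmild y₁ 2 c₁ hq
  have h0 : ((-1 : ℝ), (0 : ℝ)).1 < 0 := by norm_num
  have hD0 : D ((-1 : ℝ), 0) ≠ 0 := by simpa [hD, he₂] using hne
  -- a box around `(−1,0)` on which `D ≠ 0` and `s < 0`
  obtain ⟨ε, hε, hball⟩ : ∃ ε > 0, ∀ q : ℝ × ℝ, dist q ((-1 : ℝ), (0 : ℝ)) < ε → D q ≠ 0 := by
    have hev := ((hDa _ h0).continuousAt).eventually_ne hD0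
    obtain ⟨ε, hε, h⟩ := Metric.eventually_nhds_iff.1 hev
    exact ⟨ε, hε, fun q hq => h hq⟩
  set ρ : ℝ := min ε (1 / 2) / 2 with hρ
  have hρ0 : 0 < ρ := by rw [hρ]; positivity
  have hρε : 2 * ρ ≤ ε := by rw [hρ]; linarith [min_le_left ε (1/2)]
  have hρhalf : 2 * ρ ≤ 1 / 2 := by rw [hρ]; linarith [min_le_right ε (1/2)]
  have hbox : ∀ q : ℝ × ℝ, |q.1 + 1| < 2 * ρ → |q.2| < 2 * ρ → q.1 < 0 ∧ D q ≠ 0 := by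
    intro q h1 h2
    refine ⟨by linarith [(abs_lt.1 h1).2], hball q ?_⟩
    rw [Prod.dist_eq, Real.dist_eq, Real.dist_eq, sub_zero, show q.1 - -1 = q.1 + 1 by ring]
    exact lt_of_lt_of_le (max_lt h1 h2) hρε
  -- the ratio and the bumps
  set g : ℝ × ℝ → ℝ := fun q => Nn q / D q with hg
  have hga : ∀ q : ℝ × ℝ, |q.1 + 1| < 2 * ρ → |q.2| < 2 * ρ → ContDiffAt ℝ 3 g q := by
    intro q h1 h2
    obtain ⟨hq, hDq⟩ := hbox q h1 h2
    exact ((hNa q hq).div (hDa q hq) hDq).contDiffAt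
  let φ : ContDiffBump (-1 : ℝ) := ⟨ρ, 3 * ρ / 2, hρ0, by linarith⟩
  let ψ : ContDiffBump (0 : ℝ) := ⟨ρ, 3 * ρ / 2, hρ0, by linarith⟩
  set χ : ℝ × ℝ → ℝ := fun q => φ q.1 * ψ q.2 with hχ
  have hχc : ContDiff ℝ 3 χ := ((φ.contDiff (n := 3)).comp contDiff_fst).mul ((ψ.contDiff (n := 3)).comp contDiff_snd)
  have hχ1 : ∀ q : ℝ × ℝ, |q.1 + 1| < ρ → |q.2| < ρ → χ q = 1 := by
    intro q h1 h2
    have e1 : φ q.1 = 1 := φ.one_of_mem_closedBall (by rw [mem_closedBall, Real.dist_eq, show q.1 - -1 = q.1 + 1 by ring]; exact h1.le)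
    have e2 : ψ q.2 = 1 := ψ.one_of_mem_closedBall (by rw [mem_closedBall, Real.dist_eq, sub_zero]; exact h2.le)
    simp [hχ, e1, e2]
  have hχ0 : ∀ q : ℝ × ℝ, ¬ (|q.1 + 1| < 2 * ρ ∧ |q.2| < 2 * ρ) → ∀ᶠ q' in 𝓝 q, χ q' = 0 := by
    intro q hq
    rcases not_and_or.1 hq with h | h
    · push Not at h
      have hev : ∀ᶠ q' : ℝ × ℝ in 𝓝 q, 3 * ρ / 2 < |q'.1 + 1| :=
        (continuous_abs.comp (continuous_fst.add continuous_const)).continuousAt.eventually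
          (lt_mem_nhds (show 3 * ρ / 2 < |q.1 + 1| by linarith))
      filter_upwards [hev] with q' hq'
      have : φ q'.1 = 0 := φ.zero_of_le_dist (by rw [Real.dist_eq, show q'.1 - -1 = q'.1 + 1 by ring]; exact hq'.le)
      simp [hχ, this]
    · push Not at h
      have hev : ∀ᶠ q' : ℝ × ℝ in 𝓝 q, 3 * ρ / 2 < |q'.2| :=
        (continuous_abs.comp continuous_snd).continuousAt.eventually (lt_mem_nhds (show 3 * ρ / 2 < |q.2| by linarith))
      filter_upwards [hev] with q' hq'
      have : ψ q'.2 = 0 := ψ.zero_of_le_dist (by rw [Real.dist_eq, sub_zero]; exact hq'.le)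
      simp [hχ, this]
  -- the slope function
  refine ⟨fun s z => χ (s, z) * g (s, z), ?_, ?_, ?_⟩
  · -- `C³`
    have e : uncurry (fun s z => χ (s, z) * g (s, z)) = fun q => χ q * g q := by funext q; rfl
    rw [e]
    refine contDiff_iff_contDiffAt.2 fun q => ?_
    by_cases hq : |q.1 + 1| < 2 * ρ ∧ |q.2| < 2 * ρ
    · exact hχc.contDiffAt.mul (hga q hq.1 hq.2)
    · have hev := hχ0 q hq
      have hzero : (fun q => χ q * g q) =ᶠ[𝓝 q] fun _ => 0 := by
        filter_upwards [hev] with q' hq'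
        rw [hq', zero_mul]
      exact (contDiffAt_const (c := (0 : ℝ))).congr_of_eventuallyEq hzero
  · -- the (TH) identity near every point of the plane
    intro y hy
    have hU : ∀ᶠ z in 𝓝 (((-1 : ℝ), y) : ℝ × EuclideanSpace ℝ (Fin 3)), |z.1 + 1| < ρ ∧ |z.2 2| < ρ := by
      have h1 : ∀ᶠ z : ℝ × EuclideanSpace ℝ (Fin 3) in 𝓝 ((-1 : ℝ), y), |z.1 + 1| < ρ := by
        have hc : Continuous fun z : ℝ × EuclideanSpace ℝ (Fin 3) => |z.1 + 1| := continuous_abs.comp (continuous_fst.add continuous_const)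
        exact hc.continuousAt.eventually (gt_mem_nhds (show (fun z : ℝ × EuclideanSpace ℝ (Fin 3) => |z.1 + 1|) ((-1 : ℝ), y) < ρ by simpa using hρ0))
      have h2 : ∀ᶠ z : ℝ × EuclideanSpace ℝ (Fin 3) in 𝓝 ((-1 : ℝ), y), |z.2 2| < ρ := by
        have hc : Continuous fun z : ℝ × EuclideanSpace ℝ (Fin 3) => |z.2 2| :=
          continuous_abs.comp ((EuclideanSpace.proj (𝕜 := ℝ) (2 : Fin 3)).continuous.comp continuous_snd)
        exact hc.continuousAt.eventually (gt_mem_nhds (show (fun z : ℝ × EuclideanSpace ℝ (Fin 3) => |z.2 2|) ((-1 : ℝ), y) < ρ by simp only [hy, abs_zero]; exact hρ0))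
      exact h1.and h2
    filter_upwards [hU] with z hz b hb
    obtain ⟨hs, hDz⟩ := hbox (z.1, z.2 2) (by simpa using lt_of_lt_of_le hz.1 (by linarith)) (by simpa using lt_of_lt_of_le hz.2 (by linarith))
    -- the bilinear identity between `z.2` and the family point at the same height
    have hheight : z.2 2 = (y₁ + (z.2 2) • e₂) 2 := by simp [he₂, hy₁]
    have hbil := hTH z.1 hs z.2 (y₁ + (z.2 2) • e₂) hheight b c₁ hb hc₁
    show fderiv ℝ (v z.1) z.2 (EuclideanSpace.single 2 1) b = χ (z.1, z.2 2) * g (z.1, z.2 2) * fderiv ℝ (v z.1) z.2 (EuclideanSpace.single b 1) 2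
    rw [hχ1 (z.1, z.2 2) (by simpa using hz.1) (by simpa using hz.2), one_mul]
    simp only [hg, hNn, hD] at hDz ⊢
    field_simp
    linarith [hbil]
  · -- the value at `(−1, 0)`
    show χ ((-1 : ℝ), 0) * g ((-1 : ℝ), 0) = _
    rw [hχ1 ((-1 : ℝ), 0) (by simp [hρ0]) (by simp [hρ0]), one_mul]
    simp [hg, hNn, hD, he₂]

end Summit.NavierStokesRegularity.NavierStokesRegularity.Theorems.PoloidalWindowDoorLrcModEntireTwistingTHSlopeFunction
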